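import Literature.NumberTheory.EllipticCurves.HeegnerPointsRationalOverHilbertClassField
import Literature.NumberTheory.EllipticCurves.HeegnerPointsOfConductor
import Literature.NumberTheory.EllipticCurves.HeegnerPointsShimuraReduction
import Summits.BirchSwinnertonDyer.BirchSwinnertonDyer.Theorems.ClassRecordThreeKolyGlue
import HarnessLib

/-!
# Route `KolyvaginRoadThree` — seam G-a CLOSED: the conductor-`1` Kolyvagin–Heegner datum EXISTS on every frame
# (`Nonempty (KolyvaginHeegnerData Dt β ι 1)` from Darmon 2004 Thm. 3.6; `--supports stmt-BirchSwinnertonDyer-19156`)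

Cell `bsd-stepL` (run/shared/lean/pub/bsd-stepL/), seat `bsd-stepL-koly` (prover, Kolyvagin road); planner rulings
(R-aj)/(R-an)(2). The A1 kernel of route `KolyvaginRoadThree`, `Koly.bsdp_three_onA1_of_kolyvaginFrames`
(`Theorems/ClassRecordThreeKolyGlue.lean`, koly p410690), and the route's support item `PublishedInputsKolyThree`
(`stmt-BirchSwinnertonDyer-19156`, last conjunct) carry the HYPOTHESIS SHAPE `hKD` (seam G-a of
`plan/K2KOLY/DESIGN.md` §3): for every admissible frame `(Dt, β, ι)` of an imaginary quadratic Heegner field `K`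
(`4N ∣ β² − d_K`), a conductor-`1` Kolyvagin–Heegner datum `d : KolyvaginHeegnerData Dt β ι 1`
(`HeegnerPointsOfConductor.lean`) EXISTS. Of its fields only `y = y(1) ∈ E(K[1])` with `map_y : y ↦ φ(x(1))` has
mathematical content — *"the point `x_1` is rational over `K_1`, the Hilbert class field of `K` … `y_1 = φ(x_1)` in
`E(K_1)`"* (Gross 1991, §1), i.e. Darmon 2004, Thm. 3.6 at conductor `1`, now the tree's NAMED fact
`phi_heegnerTau_mem_range_map_singularModuliField N W K` (`HeegnerPointsRationalOverHilbertClassField.lean`;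
`K[1] = ringClassField K ι 1 = singularModuliField K ι`, `ringClassField_one`). The other fields are forced or free
at conductor `1`: `σ` is vacuous (`1` has no prime factors), `G_1 = Gal(K[1]/K[1])` is trivial so `S = 𝒢_1`
(a finite set: `K[1]/K` is finite Galois, the tree's `finiteDimensional_and_isGalois_ringClassField`), and
`emb : K[1] → K̄` over `K` is Mathlib's `IsAlgClosed.lift`.

Contents (THEOREMS ONLY; no definition, no named fact, no `sorry`):
* `nonempty_kolyvaginHeegnerData_one_of_point` — the construction: a point of `E(H_K)` over `φ(x(1))` gives the
  datum (pure algebra: transport along `H_K = K[1]`, `S = 𝒢_1`, `IsAlgClosed.lift`);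
* `nonempty_kolyvaginHeegnerData_one_of_darmon36` — **seam G-a from the named fact** (Darmon Thm. 3.6 at
  conductor `1`, applied to the Heegner form `((β² − d_K)/4, β, 1)` of `x(1)`, `heegnerFormOfConductor_mem_heegnerForms`);
* `nonempty_kolyvaginHeegnerData_one_of_isAutEquivariantOnHeegner` — the same from the tree's OTHER road to
  Thm. 3.6, the `ℚ`-rationality of `Φ_N` at CM points in transport form (`Dt.IsAutEquivariantOnHeegner d_K`,
  a predicate; `exists_point_of_isAutEquivariantOnHeegner`, `HeegnerPointsShimuraReduction.lean`, PROVED there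
  under the Heegner hypothesis);
* `kolyvaginRoadThree_hKD_of_darmon36` — the hypothesis `hKD` of p410690 ∕ the last conjunct of item 19156
  VERBATIM, from `∀ N W K, phi_heegnerTau_mem_range_map_singularModuliField N W K`;
* `bsdp_three_onA1_of_kolyvaginFrames_of_darmon36` — the A1 kernel with `hKD` DISCHARGED by the named fact:
  `BSD(E,3)` on all of A1 from the published facts, McCallum, Shimura reciprocity at conductor `1`, Darmon
  Thm. 3.6 and the deciding crux `hZ` alone.
HONEST FRAMING: closes seam G-a only (the support item's 4th conjunct becomes a NAMED published fact); the crux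
`ZhangSharpFrameAtThree` is untouched; no class of atom O2@3 moves (PARTITION: O2@3 × A1 (1 116 TRUE-OPEN
classes; cw 248 943) — types-the-object-of; closes: none).

References: [GrossLMS1991] B. H. Gross, *Kolyvagin's work on modular elliptic curves*, LMS LNS 153 (1991), §1
(pp. 235–236), §§3–4; [Darmon2004] H. Darmon, *Rational Points on Modular Elliptic Curves*, CBMS 101 (2004),
Thm. 3.6 (PDF pp. 43–44); [Cox2013] D. A. Cox, *Primes of the form x² + ny²*, 2nd ed., Thm. 11.1.
-/

noncomputable section

open scoped Classical

universe u

namespace Summit.BirchSwinnertonDyer.BirchSwinnertonDyer.Theorems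

open WeierstrassCurve Literature.NumberTheory.EllipticCurves
  Literature.NumberTheory.EllipticCurves.ModularForms

variable {K : Type u} [Field K] [NumberField K] {N : ℕ} [NeZero N] {W : WeierstrassCurve ℚ}

/-- **The conductor-`1` Kolyvagin–Heegner datum from its one contentful field.** If `φ(x(1)) ∈ E(ℂ)`
(`x(1) = τ_{((β² − d_K)/4, β, 1)}`, `heegnerPointOfConductor`; `φ(x(1)) = heegnerPointComplexOfConductor Dt d_K β 1`)
is the image of a point `P ∈ E(K[1])` (`K[1] = ringClassField K ι 1`, the Hilbert class field realised in `ℂ`;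
`= H_K`, `ringClassField_one`), then a datum `d : KolyvaginHeegnerData Dt β ι 1` exists: `y := P`; `σ` vacuous
(`1` has no prime factors); `S := 𝒢_1 = Gal(K[1]/K)` (a finite set: `K[1]/K` is finite,
`finiteDimensional_and_isGalois_ringClassField`), a transversal of the TRIVIAL subgroup `G_1 = Gal(K[1]/K[1])`;
`emb := IsAlgClosed.lift : K[1] →ₐ[K] K̄`. Pure algebra (Gross 1991 §4, (4.1) at `n = 1`:
*"`P_1 = Σ_{σ ∈ S} σ y_1 = Tr_{K_1/K}(y_1)`"*). [cite: GrossLMS1991, §4 (4.1) (S, P_n) and §1 (y_1 ∈ E(K_1))] -/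
theorem nonempty_kolyvaginHeegnerData_one_of_point (hK : IsImaginaryQuadratic K)
    (Dt : ModularParametrizationData W N) (β : ℤ) (ι : K →+* ℂ)
    (hβ : (4 * N : ℤ) ∣ β ^ 2 - NumberField.discr K)
    (P : (W.baseChange (ringClassField K ι 1)).toAffine.Point)
    (hP : WeierstrassCurve.Affine.Point.map (ringClassField K ι 1).subtype.toRatAlgHom P =
      heegnerPointComplexOfConductor Dt (NumberField.discr K) β 1) :
    Nonempty (KolyvaginHeegnerData Dt β ι 1) := by
  -- `K[1]/ℚ` is finite, so `Aut(K[1])` is finite and `K[1]/K` is algebraic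
  obtain ⟨hfd, -⟩ := finiteDimensional_and_isGalois_ringClassField hK ι one_ne_zero
  haveI := hfd
  haveI : FiniteDimensional ℚ (ringClassField K ι 1) := Module.Finite.trans K (ringClassField K ι 1)
  haveI : Algebra.IsAlgebraic K (ringClassField K ι 1) := Algebra.IsAlgebraic.of_finite K _
  -- an embedding `K[1] → K̄` over `K`
  let e : ringClassField K ι 1 →ₐ[K] AlgebraicClosure K := IsAlgClosed.lift
  refine ⟨{ dvd_sq_sub := hβ
            y := P
            map_y := hP
            σ := fun _ ↦ 1
            zpowers_σ := ?_
            S := Finset.univ.filter (· ∈ ringClassGal ι 1)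
            S_subset := fun s hs ↦ (Finset.mem_filter.mp hs).2
            S_transversal := ?_
            emb := e.toRingHom
            emb_apply := fun k ↦ e.commutes k }⟩
  · -- no prime factors at conductor 1
    intro ℓ hℓ
    rw [Nat.primeFactors_one] at hℓ
    exact absurd hℓ (Finset.notMem_empty ℓ)
  · -- `S = 𝒢_1` is a transversal of the trivial subgroup `G_1 = Gal(K[1]/K[1])`
    intro g hg
    refine ⟨g, ⟨Finset.mem_filter.mpr ⟨Finset.mem_univ _, hg⟩, ?_⟩, ?_⟩
    · rw [inv_mul_cancel]
      exact Subgroup.one_mem _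
    · rintro s ⟨-, hs⟩
      rw [ringClassGalOver, mem_fixingSubgroup_iff] at hs
      have h1 : g⁻¹ * s = 1 := by
        ext x
        have hx := hs x (show ((x : ringClassField K ι 1) : ℂ) ∈ ringClassField K ι 1 from x.2)
        rw [AlgEquiv.smul_def] at hx
        rw [hx, AlgEquiv.one_apply]
      exact (inv_mul_eq_one.mp h1).symm

/-- **`φ(x(1)) ∈ E(K[1])` from Darmon 2004, Thm. 3.6 (named fact)**: the Heegner form `((β² − d_K)/4, β, 1)` of
`x(1)` is a Heegner form of level `N` and discriminant `d_K` (`heegnerFormOfConductor_mem_heegnerForms`), so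
`φ(x(1)) ∈ E(H_K)` by `phi_heegnerTau_mem_range_map_singularModuliField N W K`, and `H_K = K[1]`
(`ringClassField_one`). Gross 1991 §1: *"`y_1 = φ(x_1)` in `E(K_1)`"*. CONDITIONAL on the named fact.
[cite: Darmon2004, Thm. 3.6 (PDF pp. 43–44)] [cite: GrossLMS1991, §1 (pp. 235–236)] -/
theorem exists_map_eq_heegnerPointComplexOfConductor_one_of_darmon36 [W.IsElliptic]
    (h36 : phi_heegnerTau_mem_range_map_singularModuliField N W K) (hK : IsImaginaryQuadratic K)
    (Dt : ModularParametrizationData W N) (β : ℤ) (ι : K →+* ℂ)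
    (hβ : (4 * N : ℤ) ∣ β ^ 2 - NumberField.discr K) :
    ∃ P : (W.baseChange (ringClassField K ι 1)).toAffine.Point,
      WeierstrassCurve.Affine.Point.map (ringClassField K ι 1).subtype.toRatAlgHom P =
        heegnerPointComplexOfConductor Dt (NumberField.discr K) β 1 := by
  have hQ := (heegnerFormOfConductor_mem_heegnerForms (N := N) hK.discr_neg hβ one_ne_zero).1
  simp only [Nat.cast_one, one_pow, one_mul] at hQ
  rw [ringClassField_one]
  exact h36 hK Dt ι hQ

/-- **Seam G-a from Darmon 2004, Thm. 3.6 (named fact).** For `E/ℚ` elliptic with model `W`, `K` imaginary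
quadratic, every frame `(Dt, β, ι)` at level `N` with `4N ∣ β² − d_K` carries a conductor-`1` Kolyvagin–Heegner
datum: `φ(x(1)) ∈ E(K[1])` by the named fact (`exists_map_eq_heegnerPointComplexOfConductor_one_of_darmon36`)
and `nonempty_kolyvaginHeegnerData_one_of_point` assembles the datum. No Heegner hypothesis needed.
CONDITIONAL on the named fact only. [cite: Darmon2004, Thm. 3.6 (PDF pp. 43–44)]
[cite: GrossLMS1991, §1 (pp. 235–236)] -/
theorem nonempty_kolyvaginHeegnerData_one_of_darmon36 [W.IsElliptic]
    (h36 : phi_heegnerTau_mem_range_map_singularModuliField N W K) (hK : IsImaginaryQuadratic K)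
    (Dt : ModularParametrizationData W N) (β : ℤ) (ι : K →+* ℂ)
    (hβ : (4 * N : ℤ) ∣ β ^ 2 - NumberField.discr K) :
    Nonempty (KolyvaginHeegnerData Dt β ι 1) := by
  obtain ⟨P, hP⟩ := exists_map_eq_heegnerPointComplexOfConductor_one_of_darmon36 h36 hK Dt β ι hβ
  exact nonempty_kolyvaginHeegnerData_one_of_point hK Dt β ι hβ P hP

/-- **Seam G-a from the `ℚ`-rationality of `Φ_N` at CM points (the tree's other road to Darmon Thm. 3.6).**
Under the Heegner hypothesis, if the datum's parametrisation is `Aut(ℂ)`-equivariant on Heegner points of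
discriminant `d_K` (`Dt.IsAutEquivariantOnHeegner d_K`: "the map `X₀(N) → E` induced by `Φ_N` is defined over
`ℚ`", Darmon's proof of Thm. 3.6, in transport form — a predicate, hypothesis here), then
`φ(x(1)) ∈ E(H_K)` by the tree's PROVED `exists_point_of_isAutEquivariantOnHeegner` (the form of `x(1)` has
`B = β`), `H_K = K[1]`, and the datum follows. CONDITIONAL on the predicate. [cite: Darmon2004, Thm. 3.6, proof (PDF p. 43)] -/
theorem nonempty_kolyvaginHeegnerData_one_of_isAutEquivariantOnHeegner [W.IsElliptic]
    (hK : IsImaginaryQuadratic K) (hH : SatisfiesHeegnerHypothesis N K)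
    (Dt : ModularParametrizationData W N) (hφ : Dt.IsAutEquivariantOnHeegner (NumberField.discr K))
    (β : ℤ) (ι : K →+* ℂ) (hβ : (4 * N : ℤ) ∣ β ^ 2 - NumberField.discr K) :
    Nonempty (KolyvaginHeegnerData Dt β ι 1) := by
  obtain ⟨hQ, hQβ⟩ := heegnerFormOfConductor_mem_heegnerForms (N := N) hK.discr_neg hβ one_ne_zero
  simp only [Nat.cast_one, one_pow, one_mul] at hQ hQβ
  have h : ∃ P : (W.baseChange (ringClassField K ι 1)).toAffine.Point,
      WeierstrassCurve.Affine.Point.map (ringClassField K ι 1).subtype.toRatAlgHom P =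
        heegnerPointComplexOfConductor Dt (NumberField.discr K) β 1 := by
    rw [ringClassField_one]
    exact exists_point_of_isAutEquivariantOnHeegner hK hH Dt hφ ι hβ hQ hQβ
  obtain ⟨P, hP⟩ := h
  exact nonempty_kolyvaginHeegnerData_one_of_point hK Dt β ι hβ P hP

/-- **The hypothesis `hKD` of the A1 kernel `Koly.bsdp_three_onA1_of_kolyvaginFrames` (p410690) ∕ the last
conjunct of the support item `PublishedInputsKolyThree` (stmt-BirchSwinnertonDyer-19156), VERBATIM, from the
named fact** `phi_heegnerTau_mem_range_map_singularModuliField` at every `(N, W, K)` (Darmon Thm. 3.6 at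
conductor `1`): on every admissible frame of an imaginary quadratic Heegner field a conductor-`1`
Kolyvagin–Heegner datum exists (the Heegner hypothesis binder is not even used). [cite: Darmon2004, Thm. 3.6 (PDF pp. 43–44)]
[cite: GrossLMS1991, §1 (y_1 ∈ E(K_1))] -/
theorem kolyvaginRoadThree_hKD_of_darmon36
    (h36 : ∀ (N : ℕ) [NeZero N] (W : WeierstrassCurve ℚ) (K : Type) [Field K] [NumberField K],
      phi_heegnerTau_mem_range_map_singularModuliField N W K) :
    ∀ (W : WeierstrassCurve ℚ) [W.IsElliptic] [W.IsGloballyMinimal] [NeZero (W.conductorNorm ℤ)]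
      (K : Type) [Field K] [NumberField K]
      (Dt : ModularParametrizationData W (W.conductorNorm ℤ)) (β : ℤ) (ι : K →+* ℂ),
      IsImaginaryQuadratic K → SatisfiesHeegnerHypothesis (W.conductorNorm ℤ) K →
      (4 * (W.conductorNorm ℤ : ℤ)) ∣ β ^ 2 - NumberField.discr K →
      Nonempty (KolyvaginHeegnerData Dt β ι 1) :=
  fun W _ _ _ K _ _ Dt β ι hK _ hβ ↦
    nonempty_kolyvaginHeegnerData_one_of_darmon36 (h36 _ W K) hK Dt β ι hβ

/-- **The A1 kernel with seam G-a DISCHARGED by name**: `Koly.bsdp_three_onA1_of_kolyvaginFrames` (koly p410690)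
with its hypothesis `hKD` supplied by Darmon 2004 Thm. 3.6 (`phi_heegnerTau_mem_range_map_singularModuliField`,
via `kolyvaginRoadThree_hKD_of_darmon36`). Under the published named facts (Gross–Zagier, Kolyvagin ×2,
Skinner 2016 Thm C, GZK, modularity, newforms, Hoffstein–Luo, Mazur's Manin constant, Shimura reciprocity at
conductor `1`, McCallum's structure theorem, Darmon Thm. 3.6) and the deciding crux in hypothesis shape `hZ`
(Kolyvagin's conjecture mod 3 at every Manin-good frame = `Theses.KolyvaginRoadThree.ZhangSharpFrameAtThree` with
`Surj`∕`Ram` unfolded): `BSD(E,3)` for every `E` on atom A1 (`(E,3) ∈ X11b`, (ram), `3 ∤ ∏c`). CONDITIONAL on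
every binder; nothing booked. [cite: Darmon2004, Thm. 3.6 (PDF pp. 43–44)] [cite: McCallumLMS1991, §5 Cor. 5.6 (p. 310)]
[cite: GrossLMS1991, §4 (4.1) and Thm. 1.3] -/
theorem bsdp_three_onA1_of_kolyvaginFrames_of_darmon36
    (hGZ : ∀ (N : ℕ) [NeZero N] (W : WeierstrassCurve ℚ) (K : Type) [Field K] [NumberField K],
      gross_zagier N W K)
    (hKo : ∀ (N : ℕ) [NeZero N] (W : WeierstrassCurve ℚ) (K : Type) [Field K] [NumberField K],
      kolyvagin N W K)
    (hB : ∀ (N : ℕ) [NeZero N] (W : WeierstrassCurve ℚ) (K : Type) [Field K] [NumberField K],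
      Kolyvagin1990_padicValNat_card_sha_le N W K)
    (hSk : Skinner2016.thmC_padicValRat_bsd_rank_zero)
    (hGZK : rank_eq_analyticRank_of_analyticRank_le_one) (hmod : hasEntireLFunction_rat)
    (hnf : exists_isNewformOf) (hHL : HoffsteinLuo1997_exists_twist_L_one_ne_zero)
    (hMaz : mazur_not_dvd_maninConstant_of_odd)
    (hrec : ∀ (N : ℕ) [NeZero N] (W : WeierstrassCurve ℚ) (K : Type) [Field K] [NumberField K],
      heegnerPointOfConductor_one_galoisConj N W K)
    (hMc : McCallum1991_pow_dvd_card_sha_primary_of_certificate)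
    (h36 : ∀ (N : ℕ) [NeZero N] (W : WeierstrassCurve ℚ) (K : Type) [Field K] [NumberField K],
      phi_heegnerTau_mem_range_map_singularModuliField N W K)
    (hZ : ∀ (W : WeierstrassCurve ℚ) [W.IsElliptic] [W.IsGloballyMinimal] [NeZero (W.conductorNorm ℤ)]
      (K : Type) [Field K] [NumberField K]
      (Dt : ModularParametrizationData W (W.conductorNorm ℤ)) (β : ℤ) (ι : K →+* ℂ),
      W.HasMultiplicativeReductionAtPrime 3 → W.HasSurjectiveModNGaloisRep 3 →
      (∃ (ℓ : ℕ) (_ : Fact ℓ.Prime), ℓ ≠ 3 ∧ W.HasMultiplicativeReductionAtPrime ℓ ∧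
        ¬ 3 ∣ padicValInt ℓ W.minimalDiscriminantInt) →
      ¬ 3 ∣ W.tamagawaProduct →
      IsImaginaryQuadratic K → SatisfiesHeegnerHypothesis (W.conductorNorm ℤ) K →
      NumberField.discr K ≠ -3 →
      (4 * (W.conductorNorm ℤ : ℤ)) ∣ β ^ 2 - NumberField.discr K → ¬ (3 : ℤ) ∣ Dt.c →
      ∃ (n : ℕ) (d : KolyvaginHeegnerData Dt β ι n),
        KolyvaginDescent.KolSupp (Zhang2014.IsKolyvaginPrime (W.conductorNorm ℤ) W K 3) n ∧
          d.kolyvaginClass Nat.prime_three 1 ≠ 0)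
    (W : WeierstrassCurve ℚ) [W.IsElliptic] [W.IsGloballyMinimal]
    (hX : Summit.BirchSwinnertonDyer.Rank1Residual.ClassX11b W 3) (hram : Rank1Residual.Ram W 3)
    (htam : ¬ 3 ∣ W.tamagawaProduct) : BSDp W 3 :=
  Summit.BirchSwinnertonDyer.Rank1Residual.X11b.Three.Koly.bsdp_three_onA1_of_kolyvaginFrames hGZ hKo hB hSk
    hGZK hmod hnf hHL hMaz hrec hMc (kolyvaginRoadThree_hKD_of_darmon36 h36) hZ W hX hram htam

end Summit.BirchSwinnertonDyer.BirchSwinnertonDyer.Theorems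
end
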